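import Literature.Dynamics.Homogeneous.OrthogonalGroupOrbitClosuresRatnerReduction
import Literature.Dynamics.Homogeneous.LinearGroupLattices
import HarnessLib

/-!
# Eichler flows of a K3 period point as unipotent one-parameter subgroups of `SO(Λ_{K3} ⊗ ℝ)`

Topic `Literature/Dynamics/Homogeneous`; auxiliary definitions and theorems (no named fact —
D-0026) preparing the reduction of
`Literature.Dynamics.Homogeneous.Verbitsky2017_orbitClosure_trichotomy_K3`
[Verbitsky2017ErgodicErratum, §2.3] to the four classical theorems
(`OrthogonalGroupOrbitClosuresClassicalReduction`, next file), in the `GL_n(ℝ)` vocabulary of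
`LinearGroupLattices`:

* `eichlerFlowGL`, `eichlerFlowGL_mem_soGL` — the Eichler flow `t ↦ exp(t T_{u,w})` (`u`
  isotropic, `w ⊥ u`; `T³ = 0`, `IsNilpotent.exp`) as a one-parameter family in `GL_n(ℝ)` with
  values in `SO(M)`: an isometry (`transpose_exp_eichlerT_mul`, via `…RatnerReduction`'s
  `exp_smul_toMatrix_eichlerT_mem`) of determinant one (`det_exp_eichlerT`: the flow at time `t`
  is the square of the flow at time `t/2`, and isometries of a non-degenerate form have
  `det = ±1`);
* `lieSubalgebraOf P` — the Lie algebra `lieSetOf P = {X | exp(ℝX) ⊆ P}` (Hall Def. 3.18)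
  transported to `End(ℝⁿ)` as a `LieSubalgebra`, given its closure under sums and commutators
  (Hall Thm. 3.20, taken as hypotheses); `toLin'_mem_skewAdjointLieSubalgebra` bridges the matrix
  skewness `Xᵀ M = −M X` to Mathlib's `skewAdjointLieSubalgebra (toBilin' M)`;
* K3 instantiation: the frame plane `k3Frame x = ⟨Re x, Im x⟩`, the generators
  `k3EichlerGenMatrices x` (matrices of the `T_{u,w}` orthogonal to the frame) and the flows
  `k3EichlerFlows x` of a period point; they are unipotent one-parameter subgroups of
  `SO(Λ_{K3} ⊗ ℝ)` (`isUnipotentOneParameterSubgroup_of_mem_k3EichlerFlows`) generating a group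
  `H = SO⁺(P_x^⊥)` that fixes the frame and `x` (`mulVec_eq_of_mem_closure_k3EichlerFlows`,
  `map_mulVec_eq_of_mem_closure_k3EichlerFlows`) — erratum §2.2 ("`H` is generated by
  unipotents"); and `k3_isLatticeIn_of_BHC`: `SO(Λ_{K3})` is a lattice in `SO(Λ_{K3} ⊗ ℝ)` given
  the Borel–Harish-Chandra theorem for orthogonal groups (as a hypothesis, stated in general).

## References

* [Verbitsky2017ErgodicErratum] M. Verbitsky, Ergodic complex structures on hyperkähler
  manifolds: an erratum, arXiv:1708.05802 (2017), §2.2–2.3.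
* [Hall2015] B. C. Hall, Lie Groups, Lie Algebras, and Representations, 2nd ed., GTM 222 (2015),
  Def. 3.18, Thm. 3.20.
* [Margulis1991] G. A. Margulis, Discrete Subgroups of Semisimple Lie Groups (1991), Ch. I
  Thm. 3.2.8 (a) (Borel–Harish-Chandra).
* [Huybrechts2016K3] D. Huybrechts, Lectures on K3 Surfaces, CUP 2016, Ch. 6 Prop. 1.5, Ch. 14
  §0.3 (vi).
-/

noncomputable section

attribute [local instance 100] LieRing.ofAssociativeRing

namespace Literature.Dynamics.Homogeneous

open scoped Matrix Topology Pointwise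
open _root_.MeasureTheory _root_.Topology _root_.Filter NormedSpace

/-! ### Eichler flows are unipotent one-parameter subgroups of `SO(M)` -/

section Flows

variable {ι : Type*} [Fintype ι] [DecidableEq ι]

/-- The matrix of an Eichler map `T_{u,w}` (`u` isotropic, `w ⊥ u`) has cube zero
(`eichlerT_pow_three`). [folklore] -/
theorem toMatrix'_eichlerT_pow_three {M : Matrix ι ι ℝ} (hM : (Matrix.toBilin' M).IsSymm)
    {u w : ι → ℝ} (huu : Matrix.toBilin' M u u = 0) (huw : Matrix.toBilin' M u w = 0) :
    LinearMap.toMatrix' (LinearMap.smulRight (Matrix.toBilin' M u) w -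
        LinearMap.smulRight (Matrix.toBilin' M w) u : Module.End ℝ (ι → ℝ)) ^ 3 = 0 := by
  rw [pow_three, ← LinearMap.toMatrix'_mul, ← LinearMap.toMatrix'_mul, ← pow_three,
    eichlerT_pow_three hM huu huw, map_zero]

/-- **The Eichler flow `exp(t T_{u,w})` preserves the form**: it is the matrix of an Eichler
transvection (`exp_smul_toMatrix_eichlerT_mem`), an isometry (`B_apply_of_mem_eichlerGens`).
[folklore] -/
theorem transpose_exp_eichlerT_mul {M : Matrix ι ι ℝ} (hM : (Matrix.toBilin' M).IsSymm)
    {u w : ι → ℝ} (huu : Matrix.toBilin' M u u = 0) (huw : Matrix.toBilin' M u w = 0) (t : ℝ) :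
    (IsNilpotent.exp (t • LinearMap.toMatrix' (LinearMap.smulRight (Matrix.toBilin' M u) w -
        LinearMap.smulRight (Matrix.toBilin' M w) u : Module.End ℝ (ι → ℝ))))ᵀ * M *
      IsNilpotent.exp (t • LinearMap.toMatrix' (LinearMap.smulRight (Matrix.toBilin' M u) w -
        LinearMap.smulRight (Matrix.toBilin' M w) u : Module.End ℝ (ι → ℝ))) = M := by
  obtain ⟨E, hE, hEq⟩ := exp_smul_toMatrix_eichlerT_mem hM (S := (∅ : Set (ι → ℝ))) huu huw
    (fun _ h => h.elim) (fun _ h => h.elim) t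
  rw [← hEq]
  exact transpose_mul_mul_eq_of_forall_apply M (B_apply_of_mem_eichlerGens hM hE)

/-- **The Eichler flow has determinant one** (for non-degenerate `M`): the flow at time `t` is
the square of the flow at time `t/2`, so its determinant is a square, while an isometry of a
non-degenerate form has determinant `±1`. [folklore] -/
theorem det_exp_eichlerT {M : Matrix ι ι ℝ} (hM : (Matrix.toBilin' M).IsSymm) (hMd : M.det ≠ 0)
    {u w : ι → ℝ} (huu : Matrix.toBilin' M u u = 0) (huw : Matrix.toBilin' M u w = 0) (t : ℝ) :
    (IsNilpotent.exp (t • LinearMap.toMatrix' (LinearMap.smulRight (Matrix.toBilin' M u) w -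
        LinearMap.smulRight (Matrix.toBilin' M w) u : Module.End ℝ (ι → ℝ)))).det = 1 := by
  set N := LinearMap.toMatrix' (LinearMap.smulRight (Matrix.toBilin' M u) w -
        LinearMap.smulRight (Matrix.toBilin' M w) u : Module.End ℝ (ι → ℝ)) with hN
  have hN3 : N ^ 3 = 0 := toMatrix'_eichlerT_pow_three hM huu huw
  have hnil : ∀ s : ℝ, IsNilpotent (s • N) := fun s => ⟨3, by rw [smul_pow, hN3, smul_zero]⟩
  -- squares of determinants of the flow are `1`
  have hsq : ∀ s : ℝ, (IsNilpotent.exp (s • N)).det * (IsNilpotent.exp (s • N)).det = 1 := by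
    intro s
    have h := congrArg Matrix.det (transpose_exp_eichlerT_mul hM huu huw s)
    rw [Matrix.det_mul, Matrix.det_mul, Matrix.det_transpose] at h
    have h' : ((IsNilpotent.exp (s • N)).det * (IsNilpotent.exp (s • N)).det - 1) * M.det = 0 := by
      linear_combination h
    rcases mul_eq_zero.1 h' with h1 | h1
    · linear_combination h1
    · exact absurd h1 hMd
  -- the flow at time `t` is the square of the flow at time `t/2`
  have hhalf : IsNilpotent.exp (t • N) =
      IsNilpotent.exp ((t / 2) • N) * IsNilpotent.exp ((t / 2) • N) := by
    rw [← IsNilpotent.exp_add_of_commute (Commute.refl _) (hnil _) (hnil _), ← add_smul,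
      add_halves]
  rw [hhalf, Matrix.det_mul]
  set d := (IsNilpotent.exp ((t / 2) • N)).det
  have h1 := hsq (t / 2)
  have h2 := hsq t
  rw [hhalf, Matrix.det_mul] at h2
  nlinarith [mul_self_nonneg d, mul_self_nonneg (d * d - 1), mul_self_nonneg (d * d + 1)]

/-- The Eichler flow `t ↦ exp(t T_{u,w})` as a one-parameter family in `GL_n(ℝ)` (the finite
exponential of a nilpotent matrix is invertible, `IsNilpotent.isUnit_exp`). [folklore] -/
def eichlerFlowGL {M : Matrix ι ι ℝ} (hM : (Matrix.toBilin' M).IsSymm)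
    {u w : ι → ℝ} (huu : Matrix.toBilin' M u u = 0) (huw : Matrix.toBilin' M u w = 0) (t : ℝ) :
    Matrix.GeneralLinearGroup ι ℝ :=
  (IsNilpotent.isUnit_exp (show IsNilpotent (t • LinearMap.toMatrix'
      (LinearMap.smulRight (Matrix.toBilin' M u) w -
        LinearMap.smulRight (Matrix.toBilin' M w) u : Module.End ℝ (ι → ℝ))) from
      ⟨3, by rw [smul_pow, toMatrix'_eichlerT_pow_three hM huu huw, smul_zero]⟩)).unit

/-- The underlying matrix of the Eichler flow is `exp(t T_{u,w})`. [folklore] -/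
theorem val_eichlerFlowGL {M : Matrix ι ι ℝ} (hM : (Matrix.toBilin' M).IsSymm)
    {u w : ι → ℝ} (huu : Matrix.toBilin' M u u = 0) (huw : Matrix.toBilin' M u w = 0) (t : ℝ) :
    ((eichlerFlowGL hM huu huw t : Matrix.GeneralLinearGroup ι ℝ) : Matrix ι ι ℝ) =
      IsNilpotent.exp (t • LinearMap.toMatrix' (LinearMap.smulRight (Matrix.toBilin' M u) w -
        LinearMap.smulRight (Matrix.toBilin' M w) u : Module.End ℝ (ι → ℝ))) :=
  IsUnit.unit_spec _

/-- **The Eichler flow takes values in `SO(M)`** (`M` non-degenerate). [folklore] -/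
theorem eichlerFlowGL_mem_soGL {M : Matrix ι ι ℝ} (hM : (Matrix.toBilin' M).IsSymm)
    (hMd : M.det ≠ 0) {u w : ι → ℝ} (huu : Matrix.toBilin' M u u = 0)
    (huw : Matrix.toBilin' M u w = 0) (t : ℝ) : eichlerFlowGL hM huu huw t ∈ soGL M := by
  rw [mem_soGL_iff, val_eichlerFlowGL]
  exact ⟨transpose_exp_eichlerT_mul hM huu huw t, det_exp_eichlerT hM hMd huu huw t⟩

end Flows

/-! ### The Lie algebra of a closed subgroup of `GL_n(ℝ)` transported to endomorphisms -/

section LieTransport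

variable {ι : Type*} [Fintype ι] [DecidableEq ι]

/-- The matrix condition `Xᵀ M = −M X` makes `toLin' X` skew-adjoint for `toBilin' M` (bridge to
Mathlib's `skewAdjointLieSubalgebra`). [folklore] -/
theorem toLin'_mem_skewAdjointLieSubalgebra {M X : Matrix ι ι ℝ} (h : Xᵀ * M = -(M * X)) :
    Matrix.toLin' X ∈ skewAdjointLieSubalgebra (Matrix.toBilin' M) := by
  rw [SkewPlane.mem_skewAdjointLieSubalgebra_iff]
  intro x y
  simp only [Matrix.toBilin'_apply', Matrix.toLin'_apply]
  rw [← Matrix.vecMul_transpose X x, ← Matrix.dotProduct_mulVec, Matrix.mulVec_mulVec, h,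
    Matrix.neg_mulVec, dotProduct_neg, ← Matrix.mulVec_mulVec]

/-- **The Lie algebra of `P` transported to `End(ℝⁿ)`**: the endomorphisms whose matrix lies in
`lieSetOf P = {X | exp(ℝX) ⊆ P}`, a Lie subalgebra of `𝔤𝔩(ℝⁿ)` GIVEN closure of `lieSetOf P` under
sums and commutators — the content of Hall's Thm. 3.20 for closed `P`, taken as hypotheses
`hadd`, `hlie` (closure under scalars is automatic, `smul_mem_lieSetOf`).
[cite: Hall2015, Def. 3.18, Thm. 3.20] -/
def lieSubalgebraOf (P : Subgroup (Matrix.GeneralLinearGroup ι ℝ))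
    (hadd : ∀ X ∈ lieSetOf P, ∀ Y ∈ lieSetOf P, X + Y ∈ lieSetOf P)
    (hlie : ∀ X ∈ lieSetOf P, ∀ Y ∈ lieSetOf P, X * Y - Y * X ∈ lieSetOf P) :
    LieSubalgebra ℝ (Module.End ℝ (ι → ℝ)) :=
  { carrier := {f | LinearMap.toMatrix' f ∈ lieSetOf P}
    add_mem' := fun {f g} hf hg => by
      show LinearMap.toMatrix' (f + g) ∈ lieSetOf P
      rw [map_add]; exact hadd _ hf _ hg
    zero_mem' := by
      show LinearMap.toMatrix' (0 : Module.End ℝ (ι → ℝ)) ∈ lieSetOf P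
      rw [map_zero]; exact zero_mem_lieSetOf P
    smul_mem' := fun c {f} hf => by
      show LinearMap.toMatrix' (c • f) ∈ lieSetOf P
      rw [map_smul]; exact smul_mem_lieSetOf hf c
    lie_mem' := fun {f g} hf hg => by
      show LinearMap.toMatrix' (⁅f, g⁆) ∈ lieSetOf P
      rw [Ring.lie_def, map_sub, LinearMap.toMatrix'_mul, LinearMap.toMatrix'_mul]
      exact hlie _ hf _ hg }

/-- Membership in the transported Lie algebra: the matrix lies in `lieSetOf P`.
[cite: Hall2015, Def. 3.18] -/
theorem mem_lieSubalgebraOf_iff {P : Subgroup (Matrix.GeneralLinearGroup ι ℝ)}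
    {hadd : ∀ X ∈ lieSetOf P, ∀ Y ∈ lieSetOf P, X + Y ∈ lieSetOf P}
    {hlie : ∀ X ∈ lieSetOf P, ∀ Y ∈ lieSetOf P, X * Y - Y * X ∈ lieSetOf P}
    (f : Module.End ℝ (ι → ℝ)) :
    f ∈ lieSubalgebraOf P hadd hlie ↔ LinearMap.toMatrix' f ∈ lieSetOf P :=
  Iff.rfl

end LieTransport

/-! ### K3 instantiation: the groups, the Eichler flows of a period point, invariance of the frame -/

section K3

open Module Submodule
open Literature.AlgebraicGeometry Literature.AlgebraicGeometry.Surfaces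

-- the real K3 Gram matrix and form (file-local notation)
local notation "𝕄" => (k3Gram.map (Int.cast : ℤ → ℝ) : Matrix K3Index K3Index ℝ)
local notation "𝔹" => Matrix.toBilin' (k3Gram.map (Int.cast : ℤ → ℝ))

/-- `det (Λ_{K3} ⊗ ℝ) = -1 ≠ 0` (`k3Gram_det`). [cite: Huybrechts2016K3, Ch. 14 §0.3 (vi)] -/
theorem det_k3GramR_ne_zero : Matrix.det 𝕄 ≠ 0 := by
  rw [det_intCast_map, k3Gram_det]; norm_num

/-- The frame plane `P_x = ⟨Re x, Im x⟩ ⊆ Λ_{K3} ⊗ ℝ` of a complex vector `x` (the positive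
`2`-plane of a period point, Huybrechts Ch. 6 Prop. 1.5). [cite: Huybrechts2016K3, Ch. 6 Prop. 1.5] -/
def k3Frame (x : K3Index → ℂ) : Submodule ℝ (K3Index → ℝ) :=
  Submodule.span ℝ (Set.range ![fun i => (x i).re, fun i => (x i).im])

/-- Unfolding of `k3Frame`. [cite: Huybrechts2016K3, Ch. 6 Prop. 1.5] -/
theorem k3Frame_eq (x : K3Index → ℂ) :
    k3Frame x = Submodule.span ℝ (Set.range ![fun i => (x i).re, fun i => (x i).im]) := rfl

/-- `Re x ∈ P_x`. [folklore] -/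
theorem re_mem_k3Frame (x : K3Index → ℂ) : (fun i => (x i).re) ∈ k3Frame x :=
  Submodule.subset_span ⟨0, rfl⟩

/-- `Im x ∈ P_x`. [folklore] -/
theorem im_mem_k3Frame (x : K3Index → ℂ) : (fun i => (x i).im) ∈ k3Frame x :=
  Submodule.subset_span ⟨1, rfl⟩

/-- The matrices of the Eichler maps `T_{u,w}` ORTHOGONAL TO THE FRAME of `x` (`u` isotropic,
`w ⊥ u`, `u, w ⊥ Re x, Im x`): the nilpotent generators of `𝔰𝔬(P_x^⊥)` (erratum §2.2, "the group
`H` is generated by unipotents"; `k3_so_frameStabilizer_mem_iff_mem_span_isotropicWedge`).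
[cite: Verbitsky2017ErgodicErratum, §2.2 (proof of the Theorem)] -/
def k3EichlerGenMatrices (x : K3Index → ℂ) : Set (Matrix K3Index K3Index ℝ) :=
  {N | ∃ u ∈ (𝔹).orthogonal (k3Frame x), ∃ w ∈ (𝔹).orthogonal (k3Frame x),
    𝔹 u u = 0 ∧ 𝔹 u w = 0 ∧
    N = LinearMap.toMatrix' (LinearMap.smulRight (𝔹 u) w - LinearMap.smulRight (𝔹 w) u :
      Module.End ℝ (K3Index → ℝ))}

/-- **The Eichler flows of a period point**: the unipotent one-parameter families
`t ↦ exp(t T_{u,w})` in `GL₂₂(ℝ)`, `T_{u,w}` a generator orthogonal to the frame of `x`; they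
generate `H = SO⁺(P_x^⊥) ≅ SO⁺(1,19)`, the group to which Verbitsky applies Ratner's theorem.
[cite: Verbitsky2017ErgodicErratum, §2.2 (the unipotent-generated `H = SO⁺(a−2,b)`)] -/
def k3EichlerFlows (x : K3Index → ℂ) : Set (ℝ → Matrix.GeneralLinearGroup K3Index ℝ) :=
  {φ | ∃ N ∈ k3EichlerGenMatrices x, ∀ t,
    ((φ t : Matrix.GeneralLinearGroup K3Index ℝ) : Matrix K3Index K3Index ℝ) =
      IsNilpotent.exp (t • N)}

/-- The generators kill the frame plane. [folklore] -/
theorem mulVec_eq_zero_of_mem_k3EichlerGenMatrices {x : K3Index → ℂ}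
    {N : Matrix K3Index K3Index ℝ} (hN : N ∈ k3EichlerGenMatrices x) {e : K3Index → ℝ}
    (he : e ∈ k3Frame x) : N *ᵥ e = 0 := by
  obtain ⟨u, hu, w, hw, -, -, rfl⟩ := hN
  rw [LinearMap.toMatrix'_mulVec]
  have hue : 𝔹 u e = 0 := by
    rw [k3RForm_comm]; exact (LinearMap.BilinForm.mem_orthogonal_iff.1 hu) e he
  have hwe : 𝔹 w e = 0 := by
    rw [k3RForm_comm]; exact (LinearMap.BilinForm.mem_orthogonal_iff.1 hw) e he
  simp [hue, hwe]

/-- The generators have cube zero. [folklore] -/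
theorem pow_three_of_mem_k3EichlerGenMatrices {x : K3Index → ℂ} {N : Matrix K3Index K3Index ℝ}
    (hN : N ∈ k3EichlerGenMatrices x) : N ^ 3 = 0 := by
  obtain ⟨u, -, w, -, huu, huw, rfl⟩ := hN
  exact toMatrix'_eichlerT_pow_three isSymm_k3RForm huu huw

/-- **The Eichler flows are unipotent one-parameter subgroups of `SO(Λ_{K3} ⊗ ℝ)`** (isometries
of determinant one, exponentials of nilpotents) — the hypothesis of Ratner's theorem for them.
[cite: Verbitsky2017ErgodicErratum, §2.2 (proof of the Theorem: `H` is generated by unipotents)] -/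
theorem isUnipotentOneParameterSubgroup_of_mem_k3EichlerFlows {x : K3Index → ℂ}
    {φ : ℝ → Matrix.GeneralLinearGroup K3Index ℝ} (hφ : φ ∈ k3EichlerFlows x) :
    IsUnipotentOneParameterSubgroup (soGL 𝕄) φ := by
  obtain ⟨N, hN, hφ⟩ := hφ
  refine ⟨fun t => ?_, N, ⟨3, pow_three_of_mem_k3EichlerGenMatrices hN⟩, hφ⟩
  obtain ⟨u, -, w, -, huu, huw, rfl⟩ := hN
  rw [mem_soGL_iff, hφ t]
  exact ⟨transpose_exp_eichlerT_mul isSymm_k3RForm huu huw t,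
    det_exp_eichlerT isSymm_k3RForm det_k3GramR_ne_zero huu huw t⟩

/-- Every generator exponentiates to an Eichler flow. [folklore] -/
theorem exists_mem_k3EichlerFlows {x : K3Index → ℂ} {N : Matrix K3Index K3Index ℝ}
    (hN : N ∈ k3EichlerGenMatrices x) :
    ∃ φ ∈ k3EichlerFlows x, ∀ t,
      ((φ t : Matrix.GeneralLinearGroup K3Index ℝ) : Matrix K3Index K3Index ℝ) =
        IsNilpotent.exp (t • N) := by
  obtain ⟨u, hu, w, hw, huu, huw, rfl⟩ := hN
  exact ⟨eichlerFlowGL isSymm_k3RForm huu huw, ⟨_, ⟨u, hu, w, hw, huu, huw, rfl⟩,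
    val_eichlerFlowGL isSymm_k3RForm huu huw⟩, val_eichlerFlowGL isSymm_k3RForm huu huw⟩

/-- **The flow group fixes the frame pointwise** (`H ≤ Stab(Re x, Im x)`). [folklore] -/
theorem mulVec_eq_of_mem_closure_k3EichlerFlows {x : K3Index → ℂ}
    {h : Matrix.GeneralLinearGroup K3Index ℝ}
    (hh : h ∈ Subgroup.closure (⋃ φ ∈ k3EichlerFlows x, Set.range φ))
    {e : K3Index → ℝ} (he : e ∈ k3Frame x) :
    (h : Matrix K3Index K3Index ℝ) *ᵥ e = e := by
  induction hh using Subgroup.closure_induction with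
  | mem g hg =>
    obtain ⟨φ, hφ, t, rfl⟩ : ∃ φ ∈ k3EichlerFlows x, ∃ t, φ t = g := by
      simpa only [Set.mem_iUnion, Set.mem_range, exists_prop] using hg
    obtain ⟨N, hN, hφN⟩ := hφ
    rw [hφN t]
    refine isNilpotentExp_mulVec_eq_self (k := 3) ?_ ?_
    · rw [smul_pow, pow_three_of_mem_k3EichlerGenMatrices hN, smul_zero]
    · rw [Matrix.smul_mulVec, mulVec_eq_zero_of_mem_k3EichlerGenMatrices hN he, smul_zero]
  | one => rw [Units.val_one, Matrix.one_mulVec]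
  | mul g g' _ _ ihg ihg' => rw [Units.val_mul, ← Matrix.mulVec_mulVec, ihg', ihg]
  | inv g _ ih =>
    have h1 : ((g⁻¹ : Matrix.GeneralLinearGroup K3Index ℝ) : Matrix K3Index K3Index ℝ) *ᵥ
        ((g : Matrix K3Index K3Index ℝ) *ᵥ e) = e := by
      rw [Matrix.mulVec_mulVec, Units.inv_mul, Matrix.one_mulVec]
    rwa [ih] at h1

/-- Elements of the flow group fix the period vector itself (they fix its frame). [folklore] -/
theorem map_mulVec_eq_of_mem_closure_k3EichlerFlows {x : K3Index → ℂ}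
    {h : Matrix.GeneralLinearGroup K3Index ℝ}
    (hh : h ∈ Subgroup.closure (⋃ φ ∈ k3EichlerFlows x, Set.range φ)) :
    (h : Matrix K3Index K3Index ℝ).map ((↑) : ℝ → ℂ) *ᵥ x = x :=
  map_ofReal_mulVec_eq_of_frame (mulVec_eq_of_mem_closure_k3EichlerFlows hh (re_mem_k3Frame x))
    (mulVec_eq_of_mem_closure_k3EichlerFlows hh (im_mem_k3Frame x))

/-- **`SO(Λ_{K3})` is a lattice in `SO(Λ_{K3} ⊗ ℝ) ≅ SO(3,19)`** — the instance of the
Borel–Harish-Chandra theorem for orthogonal groups (the hypothesis `hBHC`, see the main theorem)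
used here: `Λ_{K3}` is symmetric, unimodular (`det = −1`), of rank `22 ≥ 3`.
[cite: Margulis1991, Ch. I Thm. 3.2.8 (a)] -/
theorem k3_isLatticeIn_of_BHC
    (hBHC : ∀ (ι : Type) [Fintype ι] [DecidableEq ι] (A : Matrix ι ι ℤ), Aᵀ = A → A.det ≠ 0 →
      3 ≤ Fintype.card ι → ∀ G Γ : Subgroup (Matrix.GeneralLinearGroup ι ℝ),
        (∀ g : Matrix.GeneralLinearGroup ι ℝ, g ∈ G ↔
          (g : Matrix ι ι ℝ)ᵀ * A.map (Int.cast : ℤ → ℝ) * (g : Matrix ι ι ℝ) =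
            A.map (Int.cast : ℤ → ℝ) ∧ Matrix.det (g : Matrix ι ι ℝ) = 1) →
        (∀ g : Matrix.GeneralLinearGroup ι ℝ, g ∈ Γ ↔
          g ∈ G ∧ ∀ i j, ∃ z : ℤ, (g : Matrix ι ι ℝ) i j = z) →
        IsLatticeIn G Γ) :
    IsLatticeIn (soGL 𝕄) (soIntGL k3Gram) :=
  hBHC K3Index k3Gram k3Gram_transpose (by rw [k3Gram_det]; norm_num)
    (by simp [Fintype.card_sum, Fintype.card_fin]) _ _ (fun g => mem_soGL_iff _ g)
    (fun g => mem_soIntGL_iff_mem_soGL k3Gram g)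

end K3

end Literature.Dynamics.Homogeneous
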